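import Literature.NumberTheory.EllipticCurves.Kim2026.ShaLengthStructure
import Literature.NumberTheory.EllipticCurves.IwasawaLeadingTermProofs
import Literature.NumberTheory.EllipticCurves.SelmerCorankHolds
import Literature.NumberTheory.EllipticCurves.BSDRootNumberSmallConductorProofs
import HarnessLib

/-!
# A unit Kurihara number at a cyclic level with `ν(n)` independent points in hand: `rank E(ℚ) =
# corank Sel_{p^∞} = ν(n)`, `Ш(E/ℚ)[p^∞]` finite, and — granted `Ш(E/ℚ)` finite — `Ш(E/ℚ)[p^∞] = 0`
# (C.-H. Kim, Amer. J. Math. 148 (2026), Thm. 1.8 (1), (6) and Cor. 1.13 at a general vanishing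
# order; the kernel shape of Kim–Pollack's "elliptic curves of high rank" table), PROVED from the
# tree's published `p ≥ 5` facts

Topic `NumberTheory/EllipticCurves`; namespace `Literature.NumberTheory.EllipticCurves.Kim2026`.
THEOREMS ONLY (no new named fact; net debt `0`): every statement below is an implication whose
Kim-inputs are the two PUBLISHED named facts already in the tree,
`Kim2022_selmerCorank_le_of_kuriharaNumber_ne_zero` (Kim AJM Thm. 1.8 (1) = arXiv v4 Thm. 1.9 (1),
in the reading "a non-zero `δ̃_n^{(k)}` bounds the corank by `ν(n)`", which is also the journal's
Cor. 1.13 = store Cor. 1.14: "If `δ̃_n ≠ 0` for some `n ∈ 𝒩_1`, then `rk_ℤ E(ℚ) ≤ ν(n)`") and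
`Kim2026.kuriharaPartial_vanishingOrder_eq_padicValNat_sha_add_partialInfty_of_maninConstant`
(Thm. 1.8 (6), file `Kim2026/ShaLengthStructure`), taken as hypotheses `(hK : …) (hS : …)`, plus
proved tree theorems (`selmerCorank_eq_mordellWeilRank_add_holds`,
`finite_primaryComponent_sha_iff_shaCorank_eq_zero`, `exists_card_addPrimaryComponent_eq_pow`, the
`∂`-API of `KuriharaNumberInvariants`). Written by the cross-ladder literature-typing layer (cell
`bsd-littype`, seat 09) as the follow-up named in its OPEN-QUESTIONS-09 Q9: the rank-`0` and
rank-`1` readings of clause (6) exist (`KuriharaNumberKimShaLength`, `Kim2026/ShaLengthStructure`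
§Specialisations), the reading at a GENERAL vanishing order `r` — the one the rank-`≥ 2` tables use —
did not.

## The printed statements (C.-H. Kim, Amer. J. Math. 148 (2026) 79–129 = arXiv:2203.12159; held
text = arXiv v3, whose numbers are quoted with the journal's in brackets)

* Thm. 1.9 [journal 1.8] (PDF pp. 7–8): "Let `E` be an elliptic curve over `ℚ` and `p ≥ 5` a prime
  such that `ρ̄` is surjective and the Manin constant is prime to `p`. If `ord(δ̃) < ∞`, then (1)
  `cork_{ℤ_p} Sel(ℚ, E[p^∞]) = ord(δ̃)` … If we further assume the finiteness of `Ш(E/ℚ)[p^∞]`,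
  then … (6) `length_{ℤ_p}(Ш(E/ℚ)[p^∞]) = ∂^{(ord(δ̃))}(δ̃) − ∂^{(∞)}(δ̃)`."
* Cor. 1.14 [journal 1.13] (§1.7.3, chunk p0009:L38–L44): "We obtain the following "easy and
  practical" upper bound of the ranks of elliptic curves. … If `δ̃_n ≠ 0` for some `n ∈ 𝒩_1`, then
  `rk_ℤ E(ℚ) ≤ ν(n)`."
* C.-H. Kim–R. Pollack, appendix to arXiv:2505.09121v1 (preprint), §A.1.5 (held chunk p0027:L28–
  L80): "The following computation confirms the triviality of the `p`-primary part of
  Tate–Shafarevich groups for several elliptic curves of rank `≥ 2`" — e.g. `664.a1`, `681.a1`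
  (rank `2`, `p = 5` good ordinary, `δ̃_{11·191} ≠ 0` resp. `δ̃_{61·241} ≠ 0`), `18562.a1`,
  `20888.a1` (rank `3`, `p = 5` good ordinary). (Only the PUBLISHED `p ≥ 5` good-ordinary facts are
  used below; the `p = 3` rows of that table need the preprint's Thm. 1.1, typed OPEN in
  `Kim2025/CorankStructureOPEN`.)

## The argument (elementary, given the two facts)

Let `n` be a cyclic Kolyvagin level with `ν(n) = r` carrying a UNIT mod-`p` Kurihara number, and
suppose `r ≤ rank E(ℚ)` (the user has `r` independent points). (a) Fact (1)-reading: `cork ≤ r`;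
corank identity `cork = rank + corank Ш[p^∞]` (tree theorem): `rank ≤ cork`; hence
`rank = cork = r` and `corank Ш[p^∞] = 0`, i.e. `Ш(E/ℚ)[p^∞]` is finite — no finiteness ASSUMED.
(b) `ord(δ̃) = r` over the cyclic levels: `≤ r` by the unit at `n`; `≥ r` because a cyclic level `m`
with `δ̃_m ≠ 0` in `ℤ_p/I_m` carries a non-zero `δ̃_m^{(k)}` for some `k ≥ 1`, `m ∈ 𝒩_k`
(`exists_kuriharaNumber_ne_zero_of_kuriharaDivIndex_lt_top`), whence `r = cork ≤ ν(m)` by the fact.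
(c) Granted `Ш(E/ℚ)` finite (the binder of the clause-(6) fact), (6) at `ord = r` reads
`∂^{(r)}(δ̃) = ord_p #Ш(E/ℚ)(p) + ∂^{(∞)}(δ̃)`, and the unit gives `∂^{(r)}(δ̃) = 0`; so
`ord_p #Ш(E/ℚ)(p) = 0` and, `Ш(E/ℚ)(p)` being a finite `p`-group, `#Ш(E/ℚ)(p) = 1`.
Binders are the UNION of the two facts' binders (`p ≥ 5` good ordinary — `p ∤ a_p` is carried by the
corank fact —, `ρ̄_{E,p}` onto, datum `D` with `p ∤ c_D`, period transfer `Ω(W) = u·Ω⁺_{D.f}`,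
`|u|_p = 1`); nothing is asserted beyond the implications.

## References
* C.-H. Kim, Amer. J. Math. 148 (2026) 79–129 = arXiv:2203.12159: Thm. 1.9 (1), (6) [journal 1.8],
  Cor. 1.14 [journal 1.13] (§1.7.3), §1.4.4, §1.5.1. [Kim2022StructureSelmer]
* C.-H. Kim, R. Pollack, appendix to arXiv:2505.09121v1, §A.1.5. [Kim2025RefinedTNC]
* R. Greenberg, LNM 1716 (1999), §1 (corank identity). [Greenberg1999]
-/

noncomputable section

open scoped MatrixGroups ModularForm Classical

open CongruenceSubgroup Literature.NumberTheory.EllipticCurves.ModularForms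
  Literature.NumberTheory.EllipticCurves

namespace Literature.NumberTheory.EllipticCurves.Kim2026

section Extraction

variable (W : WeierstrassCurve ℚ) [W.IsGloballyMinimal] (p : ℕ) {N : ℕ} (f : CuspForm (Gamma0 N) 2)

/-- **A level with `δ̃_m ≠ 0` in `ℤ_p/I_mℤ_p` carries a certificate**: if
`kuriharaDivIndex W p f m < ⊤` then for some `k ≥ 1` with `m ∈ 𝒩_k` and some surjective discrete
logarithms `ψ`, `kuriharaNumber f (p^k) m ψ ≠ 0` (Kim §1.4.3: "`δ̃_n^{(k)} = δ̃_n mod p^k`"; the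
index is `⊤` exactly when every such reduction vanishes). [cite: Kim2022StructureSelmer, §1.4.3 and §1.5.1 (PDF p. 7), Def. 2.13 (PDF p. 14)] -/
theorem exists_kuriharaNumber_ne_zero_of_kuriharaDivIndex_lt_top {m : ℕ}
    (h : kuriharaDivIndex W p f m < ⊤) :
    ∃ (k : ℕ) (hk : Kato.IsKolyvaginProduct W p k m), 1 ≤ k ∧
      ∃ ψ : (ℓ : ℕ) → (ZMod ℓ)ˣ →* Multiplicative (ZMod (p ^ k)),
        (∀ ℓ ∈ m.primeFactors, Function.Surjective (ψ ℓ)) ∧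
        (haveI : NeZero m := ⟨hk.ne_zero⟩; kuriharaNumber f (p ^ k) m ψ ≠ 0) := by
  obtain ⟨j, hj⟩ := ENat.ne_top_iff_exists.mp h.ne
  have hnot : ¬ KuriharaDivisibleAt W p f m (j + 1) := by
    intro hdiv
    have hle := le_kuriharaDivIndex_of_divisibleAt W p f hdiv
    rw [← hj] at hle
    have : j + 1 ≤ j := by exact_mod_cast hle
    omega
  unfold KuriharaDivisibleAt at hnot
  push Not at hnot
  obtain ⟨k, -, hk, ψ, hψ, hne⟩ := hnot
  refine ⟨k, hk, ?_, ψ, hψ, hne⟩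
  rcases Nat.eq_zero_or_pos k with rfl | hpos
  · exfalso
    haveI : NeZero m := ⟨hk.ne_zero⟩
    haveI : Subsingleton (ZMod (p ^ 0)) := ZMod.subsingleton_iff.mpr (pow_zero p)
    exact hne (Subsingleton.elim _ _)
  · exact hpos

end Extraction

section Certificate

variable (W : WeierstrassCurve ℚ) [W.IsElliptic] [W.IsGloballyMinimal] (p : ℕ) [Fact p.Prime]
  (hK : Kim2022_selmerCorank_le_of_kuriharaNumber_ne_zero)
  (hp : 5 ≤ p) (hgood : W.HasGoodReductionAtPrime p) (hord : ¬ (p : ℤ) ∣ W.frobeniusTrace p)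
  (hsurj : W.HasSurjectiveModNGaloisRep p)
  {N : ℕ} [NeZero N] (D : ModularParametrizationData W N)
  (hu : ∃ u : ℚ, ‖(u : ℚ_[p])‖ = 1 ∧ W.realPeriodRat = u * plusPeriod D.f)
  {n : ℕ} [NeZero n] (hn : IsCyclicKolyvaginLevel W p n)
  (ψ : (ℓ : ℕ) → (ZMod ℓ)ˣ →* Multiplicative (ZMod (p ^ 1)))
  (hψ : ∀ ℓ ∈ n.primeFactors, Function.Surjective (ψ ℓ))
  (hne : kuriharaNumber D.f (p ^ 1) n ψ ≠ 0)
  (hrank : n.primeFactors.card ≤ W.mordellWeilRank)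

include hK hp hgood hord hsurj hu hn hψ hne hrank

/-- **Rank and corank from one unit Kurihara number and `ν(n)` points** (Kim AJM Thm. 1.8 (1) /
Cor. 1.13 with the corank identity): at a good ordinary `p ≥ 5` with `ρ̄_{E,p}` onto, datum `D` and
the period transfer, a UNIT mod-`p` Kurihara number `kuriharaNumber D.f p n ψ ≠ 0` at a cyclic
Kolyvagin level `n` with `ν(n) ≤ rank E(ℚ)` gives `rank E(ℚ) = ν(n)`,
`corank_{ℤ_p} Sel_{p^∞}(E/ℚ) = ν(n)` and `corank_{ℤ_p} Ш(E/ℚ)[p^∞] = 0` — no finiteness of `Ш`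
assumed. [cite: Kim2022StructureSelmer, Thm. 1.9 (1) = journal Thm. 1.8 (1) (PDF p. 7), Cor. 1.14 = journal Cor. 1.13 (§1.7.3)]
[cite: Greenberg1999, §1 (corank identity)] -/
theorem rank_eq_card_primeFactors_of_kuriharaNumber_ne_zero :
    W.mordellWeilRank = n.primeFactors.card ∧ W.selmerCorank p = n.primeFactors.card ∧
      W.shaCorank p = 0 := by
  have hcork : W.selmerCorank p ≤ n.primeFactors.card :=
    hK W p hp hgood hord hsurj D.f D.isNewformOf hu 1 n le_rfl hn.1 ψ hψ hne
  have hid := W.selmerCorank_eq_mordellWeilRank_add_holds p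
  omega

/-- **`Ш(E/ℚ)[p^∞]` is finite** under the same hypotheses (corank `0` ⟺ finite,
`finite_primaryComponent_sha_iff_shaCorank_eq_zero`). [cite: Kim2022StructureSelmer, Thm. 1.9 (1) = journal Thm. 1.8 (1) (PDF p. 7)]
[cite: Greenberg1999, §1] -/
theorem finite_primaryComponent_sha_of_kuriharaNumber_ne_zero :
    Finite (AddCommGroup.primaryComponent W.sha p) :=
  (finite_primaryComponent_sha_iff_shaCorank_eq_zero W p).2
    (rank_eq_card_primeFactors_of_kuriharaNumber_ne_zero W p hK hp hgood hord hsurj D hu hn ψ hψ hne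
      hrank).2.2

/-- **The vanishing order is `ν(n)`** over the cyclic levels: `ord(δ̃) = ν(n)` (`≤` from the unit
at `n`; `≥` because any non-vanishing cyclic level `m` bounds `cork = ν(n)` by `ν(m)`).
[cite: Kim2022StructureSelmer, Thm. 1.9 (1) = journal Thm. 1.8 (1) (PDF p. 7), §1.4.4] -/
theorem kuriharaVanishingOrder_eq_card_primeFactors_of_kuriharaNumber_ne_zero :
    kuriharaVanishingOrder W p D.f = n.primeFactors.card := by
  have hcork := (rank_eq_card_primeFactors_of_kuriharaNumber_ne_zero W p hK hp hgood hord hsurj D hu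
    hn ψ hψ hne hrank).2.1
  apply le_antisymm
  · -- the unit at `n`: index `0 < ⊤`
    have h0 : kuriharaDivIndex W p D.f n < ⊤ := by
      rw [kuriharaDivIndex_eq_zero_of_ne_zero W p D.f hn.1 ψ hψ hne]
      exact ENat.coe_lt_top 0
    exact iInf_le_of_le n (iInf_le_of_le hn (iInf_le_of_le h0 le_rfl))
  · refine le_iInf fun m => le_iInf fun hm => le_iInf fun hlt => ?_
    obtain ⟨k, hk, hk1, ψ', hψ', hne'⟩ :=
      exists_kuriharaNumber_ne_zero_of_kuriharaDivIndex_lt_top W p D.f hlt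
    haveI : NeZero m := ⟨hk.ne_zero⟩
    have hle : W.selmerCorank p ≤ m.primeFactors.card :=
      hK W p hp hgood hord hsurj D.f D.isNewformOf hu k m hk1 hk ψ' hψ' hne'
    rw [hcork] at hle
    exact_mod_cast hle

/-- **`Ш(E/ℚ)[p^∞] = 0` from one unit Kurihara number at level `ν(n) = rank`** (Kim AJM Thm. 1.8
(1) + (6) at vanishing order `ν(n)`; the kernel shape of Kim–Pollack's rank-`≥ 2` table at a good
ordinary `p ≥ 5`): granted in addition `Ш(E/ℚ)` finite (binder of the clause-(6) fact `hS`) and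
`p ∤ c_D`, `#Ш(E/ℚ)(p) = 1`. Indeed (6) at `ord = ν(n)` reads `∂^{(ν(n))} = ord_p #Ш(p) + ∂^{(∞)}`
and the unit forces `∂^{(ν(n))} = 0`. [cite: Kim2022StructureSelmer, Thm. 1.9 (1) and (6) = journal Thm. 1.8 (PDF pp. 7–8), §1.5.1]
[cite: Kim2025RefinedTNC, App. A.1.5 (held chunk p0027:L28–L31) (the printed use; preprint)] -/
theorem card_primaryComponent_sha_eq_one_of_kuriharaNumber_ne_zero
    (hS : kuriharaPartial_vanishingOrder_eq_padicValNat_sha_add_partialInfty_of_maninConstant)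
    (hfin : Finite W.sha) (hc : ¬ (p : ℤ) ∣ D.maninConstant) :
    Nat.card (AddCommGroup.primaryComponent W.sha p) = 1 := by
  have hord' := kuriharaVanishingOrder_eq_card_primeFactors_of_kuriharaNumber_ne_zero W p hK hp hgood
    hord hsurj D hu hn ψ hψ hne hrank
  obtain ⟨d, -, hpart⟩ := hS W p hp hsurj hfin D hc hu n.primeFactors.card hord'
  have hzero : kuriharaPartial W p D.f n.primeFactors.card = 0 :=
    kuriharaPartial_eq_zero_of_ne_zero W p D.f hn rfl ψ hψ hne
  rw [hzero] at hpart
  have hv : padicValNat p (Nat.card (AddCommGroup.primaryComponent W.sha p)) + d = 0 := by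
    exact_mod_cast hpart.symm
  haveI : Finite (AddCommGroup.primaryComponent W.sha p) := inferInstance
  obtain ⟨m, hm⟩ := exists_card_addPrimaryComponent_eq_pow (A := W.sha) p
  rw [hm] at hv ⊢
  rw [padicValNat.prime_pow] at hv
  have hm0 : m = 0 := by omega
  rw [hm0, pow_zero]

end Certificate

end Literature.NumberTheory.EllipticCurves.Kim2026

end
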